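import Summits.HubbardSuperconductivity.HubbardSuperconductivity.Theses.LevyLogBootstrap
import Summits.HubbardSuperconductivity.HubbardSuperconductivity.Theses.PlaquetteBoson
import Summits.HubbardSuperconductivity.HubbardSuperconductivity.Theorems.TwTipContinuation.Negative.TipNormalForm
import Summits.HubbardSuperconductivity.HubbardSuperconductivity.Theorems.PbContinuationEndpointUniqueness
import Literature.Barriers.HubbardSuperconductivity.PureModelStripeCompetition
import HarnessLib

/-!
# Disproof of `PbContinuation` ≡ `LevyLogBootstrap.Continuation` (stmt-HubbardSuperconductivity-0907) —
# findings of the standing disprover (cdisprove, cycle 1, 2026-08-17)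

One item, four routes (`PlaquetteBoson.PbContinuation`, `LevyLogBootstrap.Continuation`,
`AnisotropyChord.Continuation`, `PolyaSchurPairBoson.Continuation`; `Iff.rfl`, §0). The crux:
for ALL `U > 0`, `δ ∈ (0,1/2)`: [every-ground-state `d_{x²-y²}` order `c(t')L⁴ ≤ Re⟨Δ_d†Δ_d⟩` of the
checkerboard Hubbard tori `H_L(t',U)` for all small `t'`, eventually in `L ∈ 4ℕ`] ⟹ [the summit's
matrix at `(U,δ)`: every admissible ground-state sequence of the PURE torus `hubbardTorus 2 L 1 U` has
`d`-wave `HasLongRangeOrder` along even sides].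

## Verdict of this cycle: NO UNCONDITIONAL KILL is reachable; the crux is EXPECTED-FALSE as typed.

* §0 `continuation_iff`, `not_continuation_iff`: the crux is the POINTWISE implication
  `AnchorAt U δ → SummitAt U δ` closed over all `(U,δ)`; its negation needs ONE point with the anchor
  LIT and the pure torus DARK. Both halves are statements about interacting lattice fermions on
  arbitrarily large tori: `AnchorAt` = off-half-filling hard-core lattice BEC + a gapless dressing
  lemma (open since Kennedy–Lieb–Shastry 1988 / Aizenman–Lieb–Seiringer–Solovej–Yngvason 2004);
  `¬SummitAt` = a `T = 0` no-`B₁g`-LRO theorem for the repulsive Hubbard model at fixed `U > 0`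
  (no tool: Wick/quasi-free bounds need `U = 0`; the weak-coupling fermionic RG is controlled only
  above the BCS scale; Koma–Tasaki/Hohenberg bounds are `T > 0`). So neither a refutation nor a
  proof of any instance is in reach — concurring independently with rattack-0907, strategist s2,
  ideators r1/k1–k2 and the line lead (PICKED: none, verdict misstated).
* §1 LOAD-BEARING ANALYSIS. `0 < U` and `δ ∈ (0,1/2)` are NOT provably load-bearing (dropping them
  adds only points where the anchor is expected dark — `U = 0` free fermions, `δ = 0` plaquette
  singlet product, `δ ≥ 1` vacuum, `δ = -1` filled band with `⟨Δ_d†Δ_d⟩ = 8L²` exactly — or where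
  sectors empty out and both sides are vacuous, `δ < -1`). The ANCHOR is load-bearing in the only
  checkable sense: without it the crux is the summit's matrix at EVERY `(U,δ)`
  (`continuationWithoutAnchor_summit`), refuted modulo the catalogued stripe conjecture
  (`continuationWithoutAnchor_false_of_stripes`). Yet no known proof architecture CONSUMES the anchor
  (§3): at the routes' `U₀ ≤ 2.7` the endpoint is emergent-BCS (`λ_{B1g} ≲ 0.06`, order `≲ 10⁻¹⁴`,
  Deng et al. 2015 p. 3; barrier `PerturbativeInvisibilityOfPairing`), reachable only by a
  weak-coupling construction for which the small-`t'` premise is idle.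
* §2 THE CORNER (expected counterexample, typed; near-misses sorried with their obstructions):
  `U ∈ (0,4)`, `δ ∈ (2/5,1/2)`: anchor LIT (dilute repulsive vacancy gas of the plaquette-boson
  liquid, boson filling `2δ ∈ (0.8,1)`; the routes' own filling-blind engine `PbInterpolation` +
  `PbParticleHole`, both PROVED, delivers it whenever it delivers `δ₀ = 1/4`), pure torus DARK in
  `B₁g` (`d_xy`/`p` lead below `n ≈ 0.6` for `U ≤ 4`: Deng–Kozik–Prokof'ev–Svistunov 2015,
  arXiv:1408.2088 p. 2; Hlubina 1999; Raghu–Kivelson–Scalapino 2010; kit j024939 of ideator k1: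
  `a_{B2g}, a_E > a_{B1g}` at `n = 0.55`). `continuation_false_of_vacancyCorner : VacancyCorner →
  ¬ Continuation` (sorry-free); `VacancyCorner` itself is the near-miss. Regime census of other
  candidate corners: none better (§2 docstring).
* §3 NATURAL STRENGTHENINGS / PROOF SHAPES REFUTED (abstract, sorry-free): (i) "(0,t₀)-order ⟹
  order at `t'=1`" — false by a crossing in `(t₀,1)` even for `∃`-GS (ideator k2,
  `Cruxes/PbContinuation/IdeationR1K2.not_abstractContinuationShape`); (ii) "two-ended / two-tiling
  sum order ⟹ order at the self-dual point" — false (`IdeationR1K2.not_abstractTwoEndedShape`,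
  TERMINUS-r1-k1 §5 B6); (iii) NEW here: "every-GS order with a `t'`-UNIFORM constant on ALL of
  `[0,1)` ⟹ EVERY-GS order at `1`" — false by a crossing AT the endpoint
  (`not_abstractUniformWalkShape`; landed copy proposed as
  `Theorems/PbContinuation/Negative/UniformWalkShapeFalse.lean`, p158787): the uniqueness hypothesis
  `UniqueAtOne` of the landed `PbContinuation.everyGSOrderFour_of_walk_of_unique` is load-bearing,
  only the `∃`-GS endpoint (`PbContinuation.exists_groundState_order_at_one`) is free;
  (iv) NEW: "order along `4ℕ` ⟹ `liminf` over `2ℕ`" (`stub_evenSides` of `Lines/birth.lean`) is not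
  bookkeeping (`not_abstractSubsequenceShape`; landed as
  `Theorems/PbContinuation/Negative/SubsequenceShapeFalse.lean`, p159107);
  (v) NEW, the sharpest: for VOLUME-INDEXED families the crux's own quantifier shape "∀ t' < 1,
  ∃ L₀(t'), ∀ L ≥ L₀(t'), every-GS lit (t'-uniform constant, unique ground states)" does not give
  order at `t' = 1` in ANY volume — crossing point `t_L = 1 - 1/(L+1) ↑ 1`
  (`Negative/EventualWalkShapeFalse.lean`, `not_abstractEventualWalkShape`, p159466): the
  irreducible model-specific input is an `L`-UNIFORM left neighbourhood of the uniform point on which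
  the checkerboard ground states stay ordered (exactly the caveat of the landed
  `PbContinuation.exists_nhds_forall_groundState_order`).
* §4 RESTATEMENTS seen from the adversary: `ContinuationE` ((∃ anchor) → (∃ summit point)) is
  summit-implied — no witness can exist unless the summit is false; `ContinuationRay`
  (`U₁ ∈ [U₀,2U₀]`, `δ₀ = 1/4`) and `PbContinuationAt U₀ (1/4)`, `U₀ ∈ [1,2]`: the disprover has NO
  candidate witness (pure torus at `n = 3/4`, `U ≤ 4` is `B₁g`-led, Deng et al. Fig. 1) — they are
  irrefutable in practice, and equally unprovable; the ray's terminus `U₁ ≤ 4 < 6` stays outside the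
  catalogued stripe box but inside Qin et al.'s "compatible with zero" zone at `(4, 1/6)`.
* §5 TARGETS: none armed (`payload.targets = []`, PICKED none). `Lines/birth.stub_noTransition` IS the
  crux on `4ℕ` sides (skelvet) — its kill = the crux's kill (§2); `stub_evenSides` — §3(iv).
* §6 PRINT: no theorem in print bears on either half; numerics on the `t'`-path are mixed — DCA:
  "Suppression of d-wave superconductivity in the checkerboard Hubbard model" (Doluweera–Macridin–
  Maier–Jarrell–Pruschke, arXiv:0806.1504 = PRB 78, 020504); DQMC: "differing conclusions concerning
  whether the pairing correlations and transition temperature are raised near half-filling by the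
  inhomogeneous hopping or not. For U/t = 4, DQMC indicates an optimal t′/t ≈ 0.4 at which the
  pairing vertex is most attractive. The optimal t′/t increases with U/t" (Ying–Mondaini–Sun–Paiva–
  Fye–Scalettar, arXiv:1401.7226 = PRB 90, 075121, p. 1, materialised); DMRG ladders: enhanced
  pairing at intermediate `t'` (Karakonstantakis–Berg–White–Kivelson, arXiv:1008.3908 = PRB 83,
  054508); CORE: Baruch–Orgad arXiv:1005.0978. Consistent with "no monotone / analytic continuation
  principle in `t'`"; none of it touches the eventual-in-`L` statement. Corner sources quoted from
  the materialised text of arXiv:1408.2088: "the ground state of the system is either d_xy-wave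
  (smaller fillings) or d_{x²-y²}-wave (higher fillings)" (p. 1); "near-vertical boundary between
  different d-wave states at n ≈ 0.6" (p. 2); "(U=4, n=0.7) … λ_{d_{x²-y²}} ∼ 0.1 … T_c/E_F ∼ 5×10⁻⁵"
  (p. 3). Search degraded this cycle (OpenAlex/S2 429, local searchd reset): TYLK 2008 4×4 ED level
  crossings cited from the crux cards, not re-read.

WHY IT RESISTS (for the provers): every attack reduces to proving or refuting ground-state LRO of an
interacting 2D lattice-fermion model at a fixed `O(1)` coupling — the summit's own difficulty — on at
least one side of the implication; degenerate parameters only produce vacuous instances (anchor dark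
or sectors empty), never a lit-anchor/dark-summit pair; finite tori cannot touch an eventual-in-`L`
statement; and the abstract shape has counter-models in dimension 2, so no bookkeeping proof exists.

Namespace `…Cruxes.PbContinuation.Disproof`; `AnchorAt`/`SummitAt` are verbatim copies of the
strategist census's (`Cruxes/PbContinuation/STRATEGY_CENSUS.lean`, not importable on the farm).
Sorries: exactly the two near-misses of §2 (`anchorAt_vacancyCorner`, `not_summitAt_vacancyCorner`).
-/

noncomputable section

set_option linter.dupNamespace false

namespace Summit.HubbardSuperconductivity.HubbardSuperconductivity.Cruxes.PbContinuation.Disproof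

open Matrix Filter
open Literature.Probability.LatticeModels Literature.MathematicalPhysics.QuantumLattice
open Summit.HubbardSuperconductivity.HubbardSuperconductivity.Theses.PlaquetteBoson (PbContinuation)
open Summit.HubbardSuperconductivity.HubbardSuperconductivity.Theses.LevyLogBootstrap (Continuation)
open Literature.Barriers.HubbardSuperconductivity (HasDWavePairFieldLROAt PureModelStripeCompetition)

/-! ## §0 Normal form -/

/-- The ANCHOR at `(U,δ)`: verbatim antecedent of the crux (small-`t'` every-GS `d`-wave order of the
checkerboard tori, eventually in `L ∈ 4ℕ`). Copy of `Census.AnchorAt`. [folklore] -/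
def AnchorAt (U δ : ℝ) : Prop :=
  ∃ t₀ : ℝ, 0 < t₀ ∧ ∀ t' ∈ Set.Ioo (0:ℝ) t₀, ∃ c : ℝ, 0 < c ∧ ∃ L₀ : ℕ, ∀ (L : ℕ) [NeZero L],
    L₀ ≤ L → 4 ∣ L → ∀ (N : ℕ) (ψ : Fock (Orb (FermionTorus 2 L))),
      N = 2 * ⌊(1 - δ) * (L : ℝ) ^ 2 / 2⌋₊ → star ψ ⬝ᵥ ψ = 1 →
      IsGroundStateInSector
        (hamiltonian ((fermionTorusGraph 2 L) \ SimpleGraph.comap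
            (fun x : FermionTorus 2 L => fun i : Fin 2 => ((ofLex x) i : ℕ) / 2) ⊤) 1 U +
          hamiltonian ((fermionTorusGraph 2 L) ⊓ SimpleGraph.comap
            (fun x : FermionTorus 2 L => fun i : Fin 2 => ((ofLex x) i : ℕ) / 2) ⊤) t' 0) N 0 ψ →
      c * (L : ℝ) ^ 4 ≤ (expect ((pairField dWaveFormFactor L)ᴴ * pairField dWaveFormFactor L) ψ).re

/-- The SUMMIT MATRIX at `(U,δ)` (verbatim consequent) is the catalogued
`HasDWavePairFieldLROAt U δ`. [folklore] -/
abbrev SummitAt (U δ : ℝ) : Prop := HasDWavePairFieldLROAt U δ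

/-- One item, four routes: the LevyLogBootstrap copy is the PlaquetteBoson decl. [folklore] -/
theorem continuation_iff_pbContinuation : Continuation ↔ PbContinuation := Iff.rfl

/-- **Normal form.** The crux is the pointwise implication closed over ALL `(U,δ)`. [folklore] -/
theorem continuation_iff :
    Continuation ↔ ∀ (U δ : ℝ), 0 < U → δ ∈ Set.Ioo (0:ℝ) (1/2) → AnchorAt U δ → SummitAt U δ :=
  Iff.rfl

/-- **Negation normal form**: what a refutation must exhibit — ONE admissible point with the anchor
lit and the pure torus dark. [folklore] -/
theorem not_continuation_iff :
    ¬ Continuation ↔ ∃ U δ : ℝ, 0 < U ∧ δ ∈ Set.Ioo (0:ℝ) (1/2) ∧ AnchorAt U δ ∧ ¬ SummitAt U δ := by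
  rw [continuation_iff]
  push Not
  rfl

/-- The consequent in every-ground-state form (landed `summitMatrix_iff_everyGSOrder`, `δ ≥ -1`):
darkness at `(U,δ)` = a sequence of even sides carrying normalised sector ground states of the pure
torus with `o(L⁴)` `B₁g` pair structure factor. [folklore] -/
theorem summitAt_iff_everyGSOrder {U δ : ℝ} (hδ : -1 ≤ δ) :
    SummitAt U δ ↔
      (∃ c : ℝ, 0 < c ∧ ∃ L₀ : ℕ, ∀ (L : ℕ) [NeZero L], L₀ ≤ L → Even L →
        ∀ ψ : Fock (Orb (FermionTorus 2 L)), star ψ ⬝ᵥ ψ = 1 →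
          IsGroundStateInSector (hubbardTorus 2 L 1 U) (2 * ⌊(1 - δ) * (L : ℝ) ^ 2 / 2⌋₊) 0 ψ →
            c * (L : ℝ) ^ 4 ≤ (expect ((pairField dWaveFormFactor L)ᴴ * pairField dWaveFormFactor L) ψ).re) :=
  Summit.HubbardSuperconductivity.TwTipContinuation.Negative.summitMatrix_iff_everyGSOrder hδ

/-! ## §1 Load-bearing analysis

* `0 < U` — NOT provably load-bearing: at `U = 0` (free fermions, Wick: `⟨Δ_d†Δ_d⟩ = O(L²·g_F²)`,
  `g_F` the Fermi-shell degeneracy) and `U < 0` (`s`-wave, not `B₁g` plaquette pairs) the anchor is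
  expected DARK, so the added instances are vacuous; every landed bookkeeping lemma of this crux is
  `U`-agnostic. Information for the prover: a proof that never uses `0 < U` is not suspicious.
* `δ ∈ (0,1/2)` — NOT provably load-bearing: `δ ≥ 1` gives `N = 0` (vacuum, `⟨Δ_d†Δ_d⟩ = 0`,
  anchor false); `δ = -1` gives the filled band (`⟨Δ_d†Δ_d⟩ = 8L²` exactly, anchor false);
  `δ < -1` empties the sector at cofinally many sides (anchor vacuously true AND summit vacuously
  true — `IsGroundStateInSector` unsatisfiable at some even `L`); `δ = 0` is the plaquette-singlet
  product (anchor expected dark); `δ ∈ [1/2,1)` needs empty plaquettes (outside the YTK dictionary,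
  anchor unknown). No δ outside `(0,1/2)` yields a lit/dark pair.
* the ANCHOR — load-bearing (below): without it the crux is the summit's matrix EVERYWHERE. -/

/-- The crux with its anchor hypothesis dropped: the summit's matrix at every admissible `(U,δ)`.
[folklore] -/
def ContinuationWithoutAnchor : Prop :=
  ∀ (U δ : ℝ), 0 < U → δ ∈ Set.Ioo (0:ℝ) (1/2) → SummitAt U δ

/-- Dropping the anchor only strengthens. [folklore] -/
theorem continuation_of_withoutAnchor (h : ContinuationWithoutAnchor) : Continuation :=
  fun U δ hU hδ _ => h U δ hU hδ

/-- Without the anchor the crux PROVES THE SUMMIT outright (witness `(1, 1/4)`): it is at least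
summit-hard. [folklore] -/
theorem continuationWithoutAnchor_summit (h : ContinuationWithoutAnchor) :
    _root_.HubbardSuperconductivity :=
  ⟨1, one_pos, 1/4, ⟨by norm_num, by norm_num⟩, h 1 (1/4) one_pos ⟨by norm_num, by norm_num⟩⟩

/-- **The anchor is load-bearing modulo the catalogued stripe conjecture**: without it the crux
asserts `d`-wave LRO of the pure torus at the stripe point `(8, 1/8)`, the negation of
`Literature.Barriers.HubbardSuperconductivity.PureModelStripeCompetition` (Qin et al. 2020, posed,
not proved). So any proof of the crux must use the anchor — or prove the summit at every `(U,δ)`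
including `(8,1/8)`. [folklore] -/
theorem continuationWithoutAnchor_false_of_stripes (hS : PureModelStripeCompetition) :
    ¬ ContinuationWithoutAnchor :=
  fun h => hS (h 8 (1/8) (by norm_num) ⟨by norm_num, by norm_num⟩)

/-- Conversely the crux holds VACUOUSLY wherever the anchor fails: `Continuation` is exactly
`∀ (U,δ), ¬AnchorAt ∨ SummitAt` — a proof must, at EACH point, refute the anchor or prove the
summit there (vacuity hazard: a no-go theorem for the plaquette-boson anchor at every `(U,δ)` would
"prove" the crux and kill the four routes' dressing items instead). [folklore] -/
theorem continuation_iff_or :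
    Continuation ↔ ∀ (U δ : ℝ), 0 < U → δ ∈ Set.Ioo (0:ℝ) (1/2) → (¬ AnchorAt U δ ∨ SummitAt U δ) := by
  rw [continuation_iff]
  refine ⟨fun h U δ hU hδ => ?_, fun h U δ hU hδ hA => ?_⟩
  · by_cases hA : AnchorAt U δ
    · exact Or.inr (h U δ hU hδ hA)
    · exact Or.inl hA
  · rcases h U δ hU hδ with hn | hs
    · exact (hn hA).elim
    · exact hs

/-- Vacuity hazard, typed: global failure of the anchor proves the crux. [folklore] -/
theorem continuation_of_forall_not_anchor
    (h : ∀ (U δ : ℝ), 0 < U → δ ∈ Set.Ioo (0:ℝ) (1/2) → ¬ AnchorAt U δ) : Continuation :=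
  fun U δ hU hδ hA => (h U δ hU hδ hA).elim

/-! ## §2 The corner wedge (expected counterexample; near-misses)

REGIME CENSUS (anchor lit? / pure torus `B₁g`-dark?), `U_c ≈ 4.58` = plaquette pair-binding edge,
`U_s ≈ 2.7` = `Δ_eff = -1` (YTK 2007):
* `U > U_c`, any `δ`: anchor DARK (no bosons; spin-½ plaquette doublets) → vacuous. Stripes
  (`U ≈ 6–8`, `δ = 1/8`, `PureModelStripeCompetition`) therefore give NO corner
  (`not_continuation_of_stripe` needs `AnchorAt 8 (1/8)`, expected false).
* `U ∈ (U_s, U_c)`, `δ = 1/4`: boson checkerboard solid (`Δ_eff < -1`) → anchor dark → vacuous;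
  `δ ≠ 1/4`: doped solid / PS — unclear both sides, no clean corner.
* `U < U_s`, `δ ∈ (0, 2/5)`: anchor lit (planar XXZ superfluid at filling `2δ`), pure torus
  `B₁g`-LIT but invisibly (`λ ≲ 0.06`) → crux expected TRUE there, unprovable (weak-coupling summit).
* `U < 4`, `δ ∈ (2/5, 1/2)`: anchor lit (dilute vacancies, most credible regime), pure torus
  `d_xy`/`p` → **the corner**. `δ → 0⁺`: anchor → dark (no bosons at `δ = 0`), pure torus AF —
  not a clean corner. `δ ≥ 1/2`: outside the window (and outside the dictionary).
* every-GS fragility at `t' = 1`: an exactly degenerate dark sector ground state of the pure torus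
  along a subsequence of even `L` would also break `SummitAt` (§3(iii)); no mechanism known at
  `δ > 0`, irrefutable beyond `L = 6`. -/

/-- **Corner lemma** on the literal terms: one admissible lit/dark point refutes the crux. [folklore] -/
theorem not_continuation_of_corner {U δ : ℝ} (hU : 0 < U) (hδ : δ ∈ Set.Ioo (0:ℝ) (1/2))
    (hA : AnchorAt U δ) (hN : ¬ SummitAt U δ) : ¬ Continuation :=
  fun h => hN (h U δ hU hδ hA)

/-- The stripe point is NOT a corner unless the anchor is lit at `U = 8 > U_c` (it is expected dark:
no plaquette pair binding). Recorded to stop the tempting but empty reduction. [folklore] -/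
theorem not_continuation_of_stripe (hS : PureModelStripeCompetition) (hA : AnchorAt 8 (1/8)) :
    ¬ Continuation :=
  not_continuation_of_corner (by norm_num) ⟨by norm_num, by norm_num⟩ hA hS

/-- The VACANCY CORNER (typed physical counterexample region): some `U ∈ (0,4)`, `δ ∈ (2/5,1/2)` with
the anchor lit and the pure torus `B₁g`-dark. Deng–Kozik–Prokof'ev–Svistunov 2015 (arXiv:1408.2088
p. 2: `d_xy` below `n ≈ 0.6` for `U ≤ 4`); Yao–Tsai–Kivelson 2007 pp. 2–3 (plaquette-boson liquid).
[conjecture] -/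
def VacancyCorner : Prop :=
  ∃ U ∈ Set.Ioo (0:ℝ) 4, ∃ δ ∈ Set.Ioo (2/5 : ℝ) (1/2), AnchorAt U δ ∧ ¬ SummitAt U δ

/-- **`¬ Continuation` modulo the vacancy corner** (negative-lemma shape; `VacancyCorner` is an open
physical statement, not a constructible object, so this is NOT filed `--negative-modulo`). [folklore] -/
theorem continuation_false_of_vacancyCorner (h : VacancyCorner) : ¬ Continuation := by
  obtain ⟨U, hU, δ, hδ, hA, hN⟩ := h
  exact not_continuation_of_corner hU.1 ⟨by linarith [hδ.1], hδ.2⟩ hA hN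

/-- NEAR-MISS (lit side of the corner at `(2, 9/20)`): anchor-type every-GS `d`-wave order of the
checkerboard tori at boson filling `0.9`. OBSTRUCTION: = planar LRO of the `S=½` XXZ torus at
`Δ_eff(2) ≈ -0.99` in the sector `ρ_b = 0.9` (off half filling: no reflection positivity; open since
KLS 1988 / ALSSY 2004) PLUS an `L`-uniform dressing lemma through the gapless Schrieffer–Wolff
remainder (stability known for gapped phases only, Bravyi–Hastings–Michalakis 2010). Tried: nothing
cheaper exists — the routes' own items 0904/0906/8148 are exactly this at `δ₀ = 1/4`, and
`PbInterpolation`/`PbParticleHole` (proved) make the engine filling-blind, so the corner's anchor is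
AS HARD AS, not harder than, the routes' anchor. [conjecture] -/
theorem anchorAt_vacancyCorner : AnchorAt 2 (9/20) := by
  sorry

/-- NEAR-MISS (dark side of the corner at `(2, 9/20)`): some admissible ground-state sequence of the
pure torus at `n = 0.55`, `U = 2` lacks `d_{x²-y²}` pair LRO. OBSTRUCTION: a `T = 0` statement on
the repulsive Hubbard ground state at fixed `U = 2`; the leading Kohn–Luttinger channel there is
`B₂g`/`E` (second order: `a_{B2g} = 5.7e-4, a_E = 5.8e-4 > a_{B1g} = 2.1e-4`, kit j024939 of ideator
k1; BDMC wall at `n ≈ 0.6`, Deng et al. 2015), but NO convergent expansion reaches `T = 0`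
(barriers `WeakCouplingCeiling`, `PerturbativeInvisibilityOfPairing`); a channel-resolved Cooper-log
CEILING for the non-leading `B₁g` susceptibility would suffice and does not exist. Tried: Wick-type
bounds (need `U = 0`), Koma–Tasaki (`T > 0` only), symmetry (`Δ_d†Δ_d` is `D₄`-invariant, no
selection rule kills it). [conjecture] -/
theorem not_summitAt_vacancyCorner : ¬ SummitAt 2 (9/20) := by
  sorry

/-- The corner assembled (depends on the two near-misses above, hence NOT a refutation). -/
theorem vacancyCorner_of_nearMisses : VacancyCorner :=
  ⟨2, ⟨by norm_num, by norm_num⟩, 9/20, ⟨by norm_num, by norm_num⟩,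
    anchorAt_vacancyCorner, not_summitAt_vacancyCorner⟩

/-! ## §3 Natural strengthenings / proof shapes refuted (abstract, sorry-free)

(i) `IdeationR1K2.not_abstractContinuationShape` (k2): `(0,t₀)`-every-GS order ⇏ even `∃`-GS order at
`t = 1` (2×2 crossing at `t = 1/2`). (ii) `IdeationR1K2.not_abstractTwoEndedShape`: both arms lit ⇏
self-dual point lit (3×3). (iii) below, NEW: the whole-walk, `t`-uniform, every-GS hypothesis ⇏
EVERY-GS order at the endpoint (crossing AT `t = 1`) — so in the census decomposition D4
(`UniformWalkIco ∧ UniqueAtOne → EveryGSOrderFour`, landed as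
`PbContinuation.everyGSOrderFour_of_walk_of_unique`) the hypothesis `UniqueAtOne` is load-bearing and
only `PbContinuation.exists_groundState_order_at_one` is free. (iv) below, NEW: the mod-4 residue.
(v) landed only (not copied here): `Summit.HubbardSuperconductivity.PbContinuation.Negative.
not_abstractEventualWalkShape` (`Theorems/PbContinuation/Negative/EventualWalkShapeFalse.lean`) —
`¬ ∀ (A V : ℕ → Matrix (Fin 2) (Fin 2) ℝ) P, P.PosSemidef → (∀ t < 1, ∃ L₀, ∀ L ≥ L₀, every unit GS of
A L + t • V L has 1 ≤ ⟨P⟩) → ∃ L₀, ∀ L ≥ L₀, every unit GS of A L + V L has 0 < ⟨P⟩`; witness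
`A L = diag(0, -1 + 1/(L+1))`, `V L = diag(0,1)`, `P = diag(0,1)`: the lit neighbourhoods of each
volume shrink onto the endpoint, so NO fixed-`t'` information (however strong) is `L`-uniform. -/

theorem walkToy_form (t : ℝ) (v : Fin 2 → ℝ) :
    v ⬝ᵥ (Matrix.diagonal ![(0 : ℝ), -1] + t • Matrix.diagonal ![(0 : ℝ), 1]) *ᵥ v =
      (t - 1) * v 1 ^ 2 := by
  simp [Matrix.mulVec, dotProduct, Fin.sum_univ_two, Matrix.diagonal, Matrix.add_apply]
  ring

theorem walkToy_form_one (v : Fin 2 → ℝ) :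
    v ⬝ᵥ (Matrix.diagonal ![(0 : ℝ), -1] + Matrix.diagonal ![(0 : ℝ), 1]) *ᵥ v = 0 := by
  simp [Matrix.mulVec, dotProduct, Fin.sum_univ_two, Matrix.diagonal, Matrix.add_apply]

theorem walkToy_formP (v : Fin 2 → ℝ) : v ⬝ᵥ Matrix.diagonal ![(0 : ℝ), 1] *ᵥ v = v 1 ^ 2 := by
  simp [Matrix.mulVec, dotProduct, Fin.sum_univ_two, Matrix.diagonal]
  ring

theorem walkToy_norm (v : Fin 2 → ℝ) : v ⬝ᵥ v = v 0 ^ 2 + v 1 ^ 2 := by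
  simp [dotProduct, Fin.sum_univ_two]
  ring

/-- **(iii) The uniform-walk shape is FALSE** (exact level crossing AT `t = 1`): `A = diag(0,-1)`,
`V = diag(0,1)`, `P = diag(0,1) ≥ 0`; `A + tV = diag(0, t-1)` has unit ground states `±e₁`
(`⟨P⟩ = 1`) for EVERY `t < 1`, while `A + V = 0` has the dark ground state `e₀`. Landed copy:
`Theorems/PbContinuation/Negative/UniformWalkShapeFalse.lean` (`not_abstractUniformWalkShape`, p158787).
[folklore] -/
theorem not_abstractUniformWalkShape :
    ¬ (∀ (A V P : Matrix (Fin 2) (Fin 2) ℝ), P.PosSemidef →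
        (∀ t : ℝ, t < 1 → ∀ v : Fin 2 → ℝ, (v ⬝ᵥ v = 1 ∧ ∀ w : Fin 2 → ℝ, w ⬝ᵥ w = 1 →
            v ⬝ᵥ (A + t • V) *ᵥ v ≤ w ⬝ᵥ (A + t • V) *ᵥ w) → 1 ≤ v ⬝ᵥ P *ᵥ v) →
        ∀ v : Fin 2 → ℝ, (v ⬝ᵥ v = 1 ∧ ∀ w : Fin 2 → ℝ, w ⬝ᵥ w = 1 →
            v ⬝ᵥ (A + V) *ᵥ v ≤ w ⬝ᵥ (A + V) *ᵥ w) → 0 < v ⬝ᵥ P *ᵥ v) := by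
  intro h
  have hP : (Matrix.diagonal ![(0 : ℝ), 1]).PosSemidef :=
    Matrix.PosSemidef.diagonal (by intro i; fin_cases i <;> simp)
  have hlit : ∀ t : ℝ, t < 1 → ∀ v : Fin 2 → ℝ, (v ⬝ᵥ v = 1 ∧ ∀ w : Fin 2 → ℝ, w ⬝ᵥ w = 1 →
      v ⬝ᵥ (Matrix.diagonal ![(0 : ℝ), -1] + t • Matrix.diagonal ![(0 : ℝ), 1]) *ᵥ v ≤
        w ⬝ᵥ (Matrix.diagonal ![(0 : ℝ), -1] + t • Matrix.diagonal ![(0 : ℝ), 1]) *ᵥ w) →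
      1 ≤ v ⬝ᵥ Matrix.diagonal ![(0 : ℝ), 1] *ᵥ v := by
    rintro t ht v ⟨hn, hmin⟩
    have h1 := hmin ![0, 1] (by simp [dotProduct, Fin.sum_univ_two])
    rw [walkToy_form, walkToy_form] at h1
    rw [walkToy_norm] at hn
    rw [walkToy_formP]
    simp at h1
    nlinarith [sq_nonneg (v 0), sq_nonneg (v 1)]
  have hgs : (![1, 0] : Fin 2 → ℝ) ⬝ᵥ ![1, 0] = 1 ∧ ∀ w : Fin 2 → ℝ, w ⬝ᵥ w = 1 →
      ![1, 0] ⬝ᵥ (Matrix.diagonal ![(0 : ℝ), -1] + Matrix.diagonal ![(0 : ℝ), 1]) *ᵥ ![1, 0] ≤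
        w ⬝ᵥ (Matrix.diagonal ![(0 : ℝ), -1] + Matrix.diagonal ![(0 : ℝ), 1]) *ᵥ w := by
    refine ⟨by simp [dotProduct, Fin.sum_univ_two], fun w _ => ?_⟩
    rw [walkToy_form_one, walkToy_form_one]
  have := h _ _ _ hP hlit ![1, 0] hgs
  rw [walkToy_formP] at this
  simp at this

/-- **(iv) The mod-4 residue is not bookkeeping**: a bounded nonnegative sequence can be `≥ 1` along
`4ℕ` and have `liminf` zero along `2ℕ` (`a L = 1` if `4 ∣ L`, else `0`). So `stub_evenSides` of
`Lines/birth.lean` (every-GS order of the pure torus along `L ∈ 4ℕ` ⟹ along all even `L`) needs a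
torus-comparison / uniqueness-of-the-limit input; abstractly it is false. [folklore] -/
theorem not_abstractSubsequenceShape :
    ¬ (∀ a : ℕ → ℝ, (∀ L, 0 ≤ a L ∧ a L ≤ 1) → (∀ m : ℕ, 1 ≤ a (4 * m)) →
        0 < liminf (fun k : ℕ => a (2 * k)) atTop) := by
  intro h
  set a : ℕ → ℝ := fun L => if 4 ∣ L then 1 else 0 with ha
  have hb : ∀ L, 0 ≤ a L ∧ a L ≤ 1 := by
    intro L
    by_cases h4 : 4 ∣ L <;> simp [ha, h4]
  have h4m : ∀ m : ℕ, 1 ≤ a (4 * m) := by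
    intro m
    simp [ha]
  have hpos := h a hb h4m
  -- along odd `k` the subsequence `a (2k)` vanishes, so its liminf is `≤ 0`
  have hfreq : ∃ᶠ k : ℕ in atTop, (fun k : ℕ => a (2 * k)) k ≤ 0 := by
    rw [Filter.frequently_atTop]
    intro n
    refine ⟨2 * n + 1, by omega, ?_⟩
    have : ¬ (4 ∣ 2 * (2 * n + 1)) := by omega
    simp [ha, this]
  have hbdd : Filter.IsBoundedUnder (· ≥ ·) atTop (fun k : ℕ => a (2 * k)) :=
    ⟨0, Filter.eventually_map.2 (Filter.Eventually.of_forall fun k => (hb (2 * k)).1)⟩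
  have hle : liminf (fun k : ℕ => a (2 * k)) atTop ≤ 0 :=
    Filter.liminf_le_of_frequently_le hfreq hbdd
  linarith

/-! ## §4–§6: see the module docstring (restatement audit, targets, print). -/

end Summit.HubbardSuperconductivity.HubbardSuperconductivity.Cruxes.PbContinuation.Disproof

end
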